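import Summits.QuantumFields.BalabanUV.T4Continuum.Support.NE7EtaMinimiserGaugeCovariance
import Summits.QuantumFields.BalabanUV.T4Continuum.Support.NE3ClassSixFlatWitness
import Summits.QuantumFields.BalabanUV.T4Continuum.Support.NE3EnergyWeightedShapes
import HarnessLib

/-!
# NE7EtaBackgroundFlatOrbit — route #1 of the NE7 crux (node U5): the (A)-bill of NODE O's background coordinate is
# INHABITED on the gauge orbit of the flat configuration (hdom ∧ (H∃) `hmin` ∧ NE3's covariant root amendment 4, `Z = 0`)

Cell `pub-balaban`, rung (B)+1 sub-cell t4, lineage `b2b-balaban-t4-ne7-p1`, generation 57 (CRUX PROVER NE7 #1, ruling e34b3e0c (2));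
crux skeleton `t4/skeletons/NE7-CRUX-R1.md` v1.7.16 §2 (stub S7 = NODE O's background coordinate) ∕ §3quattuordecies.  HONEST FRAMING
(page 1): FIXED FINITE T⁴, rung (B)+1; NE7 is the cell's OWN estimate, NOT PRINTED in [Balaban1984PropagatorsI]–[Balaban1989LargeFieldII]
and NOT PROVED here; continuum YM on T⁴ ⇐ BetaPertH ∧ nine spine estimates (0/9 proved); BetaPertH ⇐ (D1) ∧ (D4) ∧ CAP+tail; G-an2-4
gates asym, D1 and NE2/3/4; NOT infinite volume, NOT mass gap, NOT Clay.

WHAT ([folklore]; 0 def; 0 sorry).  `NE7Route1EndDocked.goodClause_summable_of_route1_docked` (p317648) — `CruxDecl_of`'s seam END ∘ node T ∘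
NODE O as ONE theorem — carries in its part (A) four hypotheses on the domain `dom` of data: `hdom` (closure under `U(n)`-valued
`N`-periodic gauge transformations), NE3's (H∃) `hmin` (a `RegularSup` minimiser of every run of every datum in `sfClass ε`), NE3's
COVARIANT ROOT amendment 4 `h` (energy rate `C·residualScale_k` of the discrepancy direction `Z` between the gauge-fixed run-A minimiser
and the once-averaged run-B minimiser, plus the two covariant Lipschitz conjuncts at scales `ξ²`, `ξ³`), and a reference datum `v₁ ∈ dom`.
Generation 56 recorded «a toy instance needs NE3's root at the flat datum — a structural lemma on flat admissible configurations vs the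
projected average, not trivial».  The NE3 crew HAS that lemma for the flat datum (`NE3EnergyRateFlatClass`: zero action ⇒ zero curvature ⇒
pure gauge; the constraint kills the cycle holonomies).  This file extends it from the flat DATUM to the flat ORBIT — the smallest `dom`
that `hdom` allows — and discharges all four (A)-hypotheses there, for every `L, N ≥ 1`, `ε, b, c ≥ 0` and every `C, Λ₁, Λ₂′ ≥ 0`:
 * §1 the BLOW-UP `z ↦ w(⌊z∕L^k⌋)` of an `N`-periodic site gauge `w` to the level-`k` lattice: unitary, `(N·L^k)`-periodic, corner values
   `w` (`uLev L · k = w`);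
 * §2 `gaugeAct_mem_flatOrbit` (= `hdom`), `flatCfg_mem_flatOrbit` (= `hv₁`);
 * §3 **`hmin_flatOrbit`** (= (H∃) `hmin` on the orbit): the pure gauge `1^{blow-up of w}` minimises run `k` of the datum `1^{w}` in
   `sfClass ε` (admissible by (45) `avgIter_gaugeAct_flatCfg`, action `0`) and is `RegularSup` (`NE3ClassSixFlatWitness.regularSup_gaugeAct_flatCfg`);
 * §4 **`exists_periodic_gauge_of_isMinimiser_flatOrbit`**: EVERY run-`k` minimiser of a datum `1^{w}` of the orbit is `1^{g}` with `g`
   unitary AND `(N·L^k)`-periodic (zero action against the blow-up competitor ⇒ zero curvature ⇒ pure gauge; the constraint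
   `1^{g∘(L^k•)} = 1^{w}` makes `w⁻¹·(g∘(L^k•))` constant, and `w`'s `N`-periodicity kills the cycle holonomies of `g`);
 * §5 **`covRoot_flatOrbit`** (= the root binder `h` of p317648 on the orbit, ANY `d`): for minimisers `U_A = 1^{g_A}` (level `k`),
   `U_B = 1^{g_B}` (level `k+1`), `rescale L (bavg L U_B) = 1^{g_B∘(L•)}` and the periodic unitary gauge `u = (g_B∘(L•))·g_A⁻¹` gives
   `U_A^{u} = W·e^{0}` EXACTLY: `Z = 0`, weighted energy `0 ≤ C·residualScale`, both covariant Lipschitz conjuncts read `‖0‖ ≤ Λ·ξ^{2,3}`.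
So the (A)-bill of the docked theorem is JOINTLY SATISFIABLE on ONE `dom` (the base point of every perturbative treatment of the
background coordinate) for all admissible letters; what it does NOT say: anything at a non-flat datum — NE3's root and (H∃) remain
HYPOTHESES there (X-A4, unseated).  NOT NE3, NOT NE7; nothing printed is asserted; no `def`, no `sorry`, axioms ⊆ {propext,
Classical.choice, Quot.sound}.  HONEST: route 1 stays KERNEL-COMPLETE AT FORM LEVEL ∕ DEPENDENT; NE7 NOT proved; spine 0∕9.
-/

set_option autoImplicit false

open scoped BigOperators Matrix Matrix.Norms.L2Operator
open NormedSpace Finset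

namespace Summit.QuantumFields.BalabanUV.T4Continuum.NE7EtaBackgroundFlatOrbit

open Literature.MathematicalPhysics.QuantumFieldTheory.Balaban1983to89
open B7Prop1Explicit B7Prop2Explicit MatrixLog UnitaryModel
open T4AveragingDeficitWall hiding Site Plane Plaq Bond
open T4AveragingDeficitWallBoundary (IsPeriodicCfg periodBox)
open B7AvgGaugeCovariance (uLev uLev_apply)
open AveragingDeficitPeriodicCounting (IsPeriodicDir isPeriodicDir_zero)
open AveragingDeficitNearIdentity (Ad_zero)
open MinimalActionLevels (levelAction levelAction_nonneg)
open MinimalActionSandwich (IsMinimiser admissible)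
open MinimalActionRate (sfClass Regular)
open MinimalActionRefine (RegularSup)
open MinimalActionWitness (flatCfg avgIter_flatCfg flatCfg_mem_sfClass levelAction_flatCfg)
open NE3EnergyShapes (residualScale residualScale_nonneg IsUnitarySite IsPeriodicSite)
open NE3EnergyWeightedShapes (energyNormW energyNormW_zero)
open NE3ResidualSliceRep (mem_sfClass_gaugeAct isPeriodicCfg_gaugeAct)
open NE3EnergyRateFlatClass (hol_plaqWord_eq_one_of_levelAction_eq_zero exists_unitary_gauge_eq_gaugeAct_flatCfg
  avgIter_gaugeAct_flatCfg apply_eq_apply_zero_of_gaugeAct_flatCfg_eq isPeriodicSite_of_gaugeAct_flatCfg gaugeAct_inv_gaugeAct')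
open NE3ClassSixFlatWitness (regularSup_gaugeAct_flatCfg)
open NE7EtaMinimiserGaugeCovariance (levelAction_gaugeAct)

noncomputable section

variable {d : ℕ} {n : Type*} [Fintype n] [DecidableEq n]

/-! ## §1 The blow-up of an `N`-periodic site gauge to the level-`k` lattice -/

/-- **CORNER VALUES OF THE BLOW-UP**: `(z ↦ w(⌊z∕L^k⌋)) ∘ (L^k •) = w` (`L ≥ 1`). [folklore] -/
theorem uLev_blowup {L : ℕ} (hL : 1 ≤ L) (w : Site d → (Matrix n n ℂ)ˣ) (k : ℕ) :
    uLev L (fun z : Site d => w (fun i => z i / ((L : ℤ) ^ k))) k = w := by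
  have hLk : ((L : ℤ) ^ k) ≠ 0 := pow_ne_zero _ (by exact_mod_cast (by omega : L ≠ 0))
  funext x
  simp only [uLev_apply]
  congr 1
  funext i
  rw [Pi.smul_apply, smul_eq_mul, Int.mul_ediv_cancel_left _ hLk]

/-- The blow-up of a unitary site gauge is unitary. [folklore] -/
theorem isUnitarySite_blowup {w : Site d → (Matrix n n ℂ)ˣ} (hw : IsUnitarySite w) (L k : ℕ) :
    IsUnitarySite (fun z : Site d => w (fun i => z i / ((L : ℤ) ^ k))) :=
  fun _ => hw _

/-- The blow-up of an `N`-periodic site gauge to the level-`k` lattice is `(N·L^k)`-periodic (`L ≥ 1`). [folklore] -/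
theorem isPeriodicSite_blowup {L : ℕ} (hL : 1 ≤ L) {N : ℕ} {w : Site d → (Matrix n n ℂ)ˣ} (hw : IsPeriodicSite w (N : ℤ))
    (k : ℕ) : IsPeriodicSite (fun z : Site d => w (fun i => z i / ((L : ℤ) ^ k))) ((N * L ^ k : ℕ) : ℤ) := by
  have hLk : ((L : ℤ) ^ k) ≠ 0 := pow_ne_zero _ (by exact_mod_cast (by omega : L ≠ 0))
  intro x j
  have hx : (fun i => (x + ((N * L ^ k : ℕ) : ℤ) • e j) i / ((L : ℤ) ^ k))
      = (fun i => x i / ((L : ℤ) ^ k)) + (N : ℤ) • e j := by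
    funext i
    simp only [Pi.add_apply, Pi.smul_apply, smul_eq_mul]
    have hc : ((N * L ^ k : ℕ) : ℤ) * e j i = ((N : ℤ) * e j i) * ((L : ℤ) ^ k) := by push_cast; ring
    rw [hc, Int.add_mul_ediv_right _ _ hLk]
  show w (fun i => (x + ((N * L ^ k : ℕ) : ℤ) • e j) i / ((L : ℤ) ^ k)) = w (fun i => x i / ((L : ℤ) ^ k))
  rw [hx, hw]

/-! ## §2 The gauge orbit of the flat configuration: closure (`hdom`) and the reference datum (`hv₁`) -/

/-- **`hdom` ON THE FLAT ORBIT**: the set `{1^{w} : w unitary, N-periodic}` is closed under unitary `N`-periodic gauge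
transformations (`(1^{w})^{w′} = 1^{w′w}`). [folklore] -/
theorem gaugeAct_mem_flatOrbit (N : ℕ) :
    ∀ v ∈ {v : Site d → Fin d → (Matrix n n ℂ)ˣ | ∃ w : Site d → (Matrix n n ℂ)ˣ,
        IsUnitarySite w ∧ IsPeriodicSite w (N : ℤ) ∧ v = gaugeAct w flatCfg},
      ∀ w' : Site d → (Matrix n n ℂ)ˣ, IsUnitarySite w' → IsPeriodicSite w' (N : ℤ) →
        gaugeAct w' v ∈ {v : Site d → Fin d → (Matrix n n ℂ)ˣ | ∃ w : Site d → (Matrix n n ℂ)ˣ,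
          IsUnitarySite w ∧ IsPeriodicSite w (N : ℤ) ∧ v = gaugeAct w flatCfg} := by
  rintro v ⟨w, hwu, hwp, rfl⟩ w' hw'u hw'p
  refine ⟨w' * w, fun x => (unitaryUnits (Matrix n n ℂ)).mul_mem (hw'u x) (hwu x), fun x i => ?_, ?_⟩
  · simp only [Pi.mul_apply]
    rw [hw'p x i, hwp x i]
  · funext x μ
    simp only [gaugeAct, Pi.mul_apply, mul_inv_rev, mul_assoc]

/-- **`hv₁` ON THE FLAT ORBIT**: the flat configuration itself lies in its orbit (`w = 1`). [folklore] -/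
theorem flatCfg_mem_flatOrbit (N : ℕ) :
    (flatCfg : Site d → Fin d → (Matrix n n ℂ)ˣ) ∈ {v : Site d → Fin d → (Matrix n n ℂ)ˣ | ∃ w : Site d → (Matrix n n ℂ)ˣ,
        IsUnitarySite w ∧ IsPeriodicSite w (N : ℤ) ∧ v = gaugeAct w flatCfg} :=
  ⟨fun _ => 1, fun _ => (unitaryUnits (Matrix n n ℂ)).one_mem, fun _ _ => rfl, by
    funext x μ; simp only [gaugeAct, one_mul, inv_one, mul_one]⟩

/-! ## §3 (H∃) on the flat orbit: the blown-up pure gauge is a `RegularSup` minimiser -/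

/-- The blown-up pure gauge `1^{z ↦ w(⌊z∕L^k⌋)}` is admissible for run `k` of the datum `1^{w}` in `sfClass ε` (`L ≥ 1`, `ε ≥ 0`,
`w` unitary `N`-periodic): it lies in the class (gauge invariance, `mem_sfClass_gaugeAct`) and its `k`-fold average is `1^{w}`
((45) `avgIter_gaugeAct_flatCfg` and §1). [folklore] -/
theorem blowup_mem_admissible [Nonempty n] {L N : ℕ} (hL : 1 ≤ L) {ε : ℝ} (hε : 0 ≤ ε) {w : Site d → (Matrix n n ℂ)ˣ}
    (hwu : IsUnitarySite w) (hwp : IsPeriodicSite w (N : ℤ)) (k : ℕ) :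
    gaugeAct (fun z : Site d => w (fun i => z i / ((L : ℤ) ^ k))) flatCfg
      ∈ admissible (sfClass d L N ε) L k (gaugeAct w flatCfg) :=
  ⟨mem_sfClass_gaugeAct (isUnitarySite_blowup hwu L k) (isPeriodicSite_blowup hL hwp k) (flatCfg_mem_sfClass L N hε k),
    by rw [avgIter_gaugeAct_flatCfg, uLev_blowup hL]⟩

/-- **(H∃) `hmin` ON THE FLAT ORBIT** — literally the binder `hmin` of `NE7Route1EndDocked.goodClause_summable_of_route1_docked` with
`dom :=` the flat orbit: for `L ≥ 1`, `ε, b, c ≥ 0`, every datum `1^{w}` (`w` unitary, `N`-periodic) and every run `k`, the blown-up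
pure gauge minimises the level-`k` action over `admissible (sfClass ε) L k (1^{w})` (its action is `0`, every `U(n)` action is `≥ 0`)
and is `RegularSup d L N b c k` (`regularSup_gaugeAct_flatCfg`). [folklore] -/
theorem hmin_flatOrbit [Nonempty n] {L N : ℕ} (hL : 1 ≤ L) {ε b c : ℝ} (hε : 0 ≤ ε) (hb : 0 ≤ b) (hc : 0 ≤ c) :
    ∀ V ∈ {v : Site d → Fin d → (Matrix n n ℂ)ˣ | ∃ w : Site d → (Matrix n n ℂ)ˣ,
        IsUnitarySite w ∧ IsPeriodicSite w (N : ℤ) ∧ v = gaugeAct w flatCfg},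
      ∀ k : ℕ, ∃ U, IsMinimiser d (sfClass d L N ε) L N k V U ∧ RegularSup d L N b c k U := by
  rintro V ⟨w, hwu, hwp, rfl⟩ k
  refine ⟨gaugeAct (fun z : Site d => w (fun i => z i / ((L : ℤ) ^ k))) flatCfg,
    ⟨blowup_mem_admissible hL hε hwu hwp k, fun U' hU' => ?_⟩,
    regularSup_gaugeAct_flatCfg (isUnitarySite_blowup hwu L k) (isPeriodicSite_blowup hL hwp k) hb hc⟩
  rw [levelAction_gaugeAct, levelAction_flatCfg]
  exact levelAction_nonneg L N k hL hU'.1.1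

/-! ## §4 Every minimiser of a datum of the flat orbit is a periodic pure gauge -/

/-- **MINIMISERS OF THE DATA OF THE FLAT ORBIT ARE PERIODIC PURE GAUGES**: for `L, N ≥ 1`, `ε ≥ 0`, `w` unitary `N`-periodic, every
run-`k` minimiser `U` of the datum `1^{w}` in `sfClass ε` is `1^{g}` with `g` unitary and `(N·L^k)`-periodic.  Zero action (the blown-up
pure gauge competes with action `0`) ⇒ zero curvature (`hol_plaqWord_eq_one_of_levelAction_eq_zero`) ⇒ `U = 1^{g}`
(`exists_unitary_gauge_eq_gaugeAct_flatCfg`); the constraint `1^{g∘(L^k•)} = 1^{w}` makes `w⁻¹·(g∘(L^k•))` constant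
(`apply_eq_apply_zero_of_gaugeAct_flatCfg_eq`), so `g((N L^k)e_i) = g(0)` by `w`'s periodicity, and `isPeriodicSite_of_gaugeAct_flatCfg`
concludes.  The flat-datum case is `NE3EnergyRateFlatClass.exists_periodic_gauge_of_isMinimiser_flatCfg`. [folklore] -/
theorem exists_periodic_gauge_of_isMinimiser_flatOrbit [Nonempty n] {L N : ℕ} (hL : 1 ≤ L) (hN : 1 ≤ N) {ε : ℝ} (hε : 0 ≤ ε)
    {w : Site d → (Matrix n n ℂ)ˣ} (hwu : IsUnitarySite w) (hwp : IsPeriodicSite w (N : ℤ)) {k : ℕ}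
    {U : Site d → Fin d → (Matrix n n ℂ)ˣ} (hU : IsMinimiser d (sfClass d L N ε) L N k (gaugeAct w flatCfg) U) :
    ∃ g : Site d → (Matrix n n ℂ)ˣ, IsUnitarySite g ∧ IsPeriodicSite g ((N * L ^ k : ℕ) : ℤ) ∧ U = gaugeAct g flatCfg := by
  obtain ⟨hUmem, havg⟩ := hU.mem
  obtain ⟨hunit, hperU, _⟩ := hUmem
  -- zero action: the blown-up pure gauge competes with action `0`
  have hA0 : levelAction d L N k U = 0 := by
    refine le_antisymm ?_ (levelAction_nonneg L N k hL hunit)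
    have h := hU.le _ (blowup_mem_admissible hL hε hwu hwp k)
    rwa [levelAction_gaugeAct, levelAction_flatCfg] at h
  -- zero curvature, pure gauge
  have hflat := hol_plaqWord_eq_one_of_levelAction_eq_zero hL hN hunit hperU hA0
  obtain ⟨g, hgu, hUg⟩ := exists_unitary_gauge_eq_gaugeAct_flatCfg hunit hflat
  refine ⟨g, hgu, ?_, hUg⟩
  -- the constraint: `1^{g ∘ (L^k •)} = 1^{w}`, so `w⁻¹ · (g ∘ (L^k •))` is constant
  have hcon : gaugeAct (uLev L g k) (flatCfg : Site d → Fin d → (Matrix n n ℂ)ˣ) = gaugeAct w flatCfg := by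
    rw [← avgIter_gaugeAct_flatCfg, ← hUg, havg]
  have hcon' : gaugeAct (fun z => (w z)⁻¹ * uLev L g k z) (flatCfg : Site d → Fin d → (Matrix n n ℂ)ˣ) = flatCfg := by
    have h1 : gaugeAct (fun z => (w z)⁻¹) (gaugeAct (uLev L g k) (flatCfg : Site d → Fin d → (Matrix n n ℂ)ˣ))
        = flatCfg := by
      rw [hcon, gaugeAct_inv_gaugeAct']
    have h2 : gaugeAct (fun z => (w z)⁻¹ * uLev L g k z) (flatCfg : Site d → Fin d → (Matrix n n ℂ)ˣ)
        = gaugeAct (fun z => (w z)⁻¹) (gaugeAct (uLev L g k) flatCfg) := by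
      funext x μ
      simp only [gaugeAct, mul_inv_rev, mul_assoc]
    rw [h2, h1]
  have hconst : ∀ z : Site d, (w z)⁻¹ * uLev L g k z = (w 0)⁻¹ * uLev L g k 0 :=
    apply_eq_apply_zero_of_gaugeAct_flatCfg_eq (G := (Matrix n n ℂ)ˣ) hcon'
  -- periodicity of `g`: the cycle holonomies are killed by `w`'s `N`-periodicity
  refine isPeriodicSite_of_gaugeAct_flatCfg (hUg ▸ hperU) fun i => ?_
  have h2 := hconst ((N : ℤ) • e i)
  have hwN : w ((N : ℤ) • e i) = w 0 := by
    have h := hwp 0 i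
    rwa [zero_add] at h
  simp only [uLev_apply, smul_zero, smul_smul, hwN] at h2
  have h3 := mul_left_cancel h2
  have hcast : ((N * L ^ k : ℕ) : ℤ) = (L : ℤ) ^ k * (N : ℤ) := by push_cast; ring
  rw [hcast]
  exact h3

/-! ## §5 NE3's covariant root amendment 4 on the flat orbit, direction `Z = 0` -/

/-- **NE3's COVARIANT ROOT (amendment 4) ON THE FLAT ORBIT** — literally the binder `h` of
`NE7Route1EndDocked.goodClause_summable_of_route1_docked` with `dom :=` the flat orbit (there `d = 4`), for `L, N ≥ 1`, `ε ≥ 0`, all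
`b, g` and every `C, Λ₁, Λ₂′ ≥ 0`: for the minimisers `U_A = 1^{g_A}` (level `k`) and `U_B = 1^{g_B}` (level `k+1`) of a datum of the
orbit (§4), `rescale L (bavg L U_B) = 1^{g_B∘(L•)}` ((45)), and the unitary `(N·L^k)`-periodic gauge `u = (g_B∘(L•))·g_A⁻¹` gives
`U_A^{u} = W·e^{0}` EXACTLY: direction `Z = 0` (skew, periodic), weighted energy `0 ≤ C·residualScale_k`, and both covariant Lipschitz
conjuncts read `‖0‖ ≤ Λ₁ξ^{2}`, `‖0‖ ≤ Λ₂′ξ^{3}`.  The base point of the background coordinate; NOTHING at a non-flat datum. [folklore] -/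
theorem covRoot_flatOrbit [Nonempty n] {L N : ℕ} (hL : 1 ≤ L) (hN : 1 ≤ N) {ε : ℝ} (hε : 0 ≤ ε) (b g : ℝ)
    {C Λ₁ Λ₂' : ℝ} (hC : 0 ≤ C) (hΛ₁ : 0 ≤ Λ₁) (hΛ₂' : 0 ≤ Λ₂') :
    ∀ k : ℕ, 1 ≤ k → ∀ V ∈ {v : Site d → Fin d → (Matrix n n ℂ)ˣ | ∃ w : Site d → (Matrix n n ℂ)ˣ,
        IsUnitarySite w ∧ IsPeriodicSite w (N : ℤ) ∧ v = gaugeAct w flatCfg},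
      ∀ UA UB : (Site d → Fin d → (Matrix n n ℂ)ˣ),
      IsMinimiser d (sfClass d L N ε) L N k V UA → IsMinimiser d (sfClass d L N ε) L N (k + 1) V UB →
        Regular d L N b g (k + 1) UB →
        ∃ (u : Site d → (Matrix n n ℂ)ˣ) (Z : Site d → Fin d → Matrix n n ℂ),
          IsUnitarySite u ∧ IsPeriodicSite u ((N * L ^ k : ℕ) : ℤ) ∧
          IsSkewDir Z ∧ IsPeriodicDir Z ((N * L ^ k : ℕ) : ℤ) ∧
          gaugeAct u UA = vary (rescale L (bavg L UB)) Z 1 ∧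
          energyNormW L k (rescale L (bavg L UB)) Z (periodBox (N * L ^ k)) ≤ C * residualScale d L N b g k ∧
          (∀ (κ : Fin d) (x : Site d) (μ : Fin d),
            ‖Ad (rescale L (bavg L UB) (x + e κ) μ) (Z (x + e μ) κ) - Z x κ‖ ≤ Λ₁ * (((L : ℝ)⁻¹) ^ k) ^ 2) ∧
          (∀ (κ μ : Fin d) (y : Site d),
            ‖Ad (rescale L (bavg L UB) (y + e κ) μ)
                (Ad (rescale L (bavg L UB) (y + e κ + e μ) μ) (Z (y + (2 : ℕ) • e μ) κ) - Z (y + e μ) κ)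
              - (Ad (rescale L (bavg L UB) (y + e κ) μ) (Z (y + e μ) κ) - Z y κ)‖ ≤ Λ₂' * (((L : ℝ)⁻¹) ^ k) ^ 3) := by
  rintro k - V ⟨w, hwu, hwp, rfl⟩ UA UB hA hB -
  obtain ⟨gA, hgAu, hgAp, hUA⟩ := exists_periodic_gauge_of_isMinimiser_flatOrbit hL hN hε hwu hwp hA
  obtain ⟨gB, hgBu, hgBp, hUB⟩ := exists_periodic_gauge_of_isMinimiser_flatOrbit hL hN hε hwu hwp hB
  -- the averaged run-B minimiser read on run A's lattice is the pure gauge `1^{g_B ∘ (L•)}`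
  have hW : rescale L (bavg L UB) = gaugeAct (uLev L gB 1) flatCfg := by
    have h := avgIter_gaugeAct_flatCfg L gB 1
    rw [← hUB] at h
    exact h
  refine ⟨fun x => uLev L gB 1 x * (gA x)⁻¹, fun (_ : Site d) (_ : Fin d) => (0 : Matrix n n ℂ),
    fun x => (unitaryUnits (Matrix n n ℂ)).mul_mem (hgBu _) ((unitaryUnits (Matrix n n ℂ)).inv_mem (hgAu x)),
    fun x i => ?_, fun _ _ => (skewAdjoint (Matrix n n ℂ)).zero_mem, isPeriodicDir_zero _, ?_, ?_, ?_, ?_⟩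
  · -- periodicity of the gauge `u`
    simp only [uLev_apply, pow_one]
    rw [hgAp x i, smul_add, smul_smul]
    have hcast : (L : ℤ) * ((N * L ^ k : ℕ) : ℤ) = ((N * L ^ (k + 1) : ℕ) : ℤ) := by push_cast; ring
    rw [hcast, hgBp]
  · -- `U_A^u = W · e^0`
    rw [vary_zero_dir, hW, hUA]
    funext x μ
    simp only [gaugeAct, flatCfg, mul_one]
    group
  · rw [energyNormW_zero]
    exact mul_nonneg hC (residualScale_nonneg d L N b g k)
  · intro κ x μ
    simp only [Ad_zero, sub_zero, norm_zero]
    positivity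
  · intro κ μ y
    simp only [Ad_zero, sub_zero, norm_zero]
    positivity

end

end Summit.QuantumFields.BalabanUV.T4Continuum.NE7EtaBackgroundFlatOrbit
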